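import Summits.QuantumFields.BalabanUV.Beta.GAN24.RelSourceHalf
import Summits.QuantumFields.BalabanUV.Beta.GAN24.ZeroModeParity
import Summits.QuantumFields.BalabanUV.Beta.GAN24.TableDressingDefect

/-!
# `BalabanUV.Beta.GAN24.RelSourceHalfCharge` — binder row G-an2-4 ∕ (CONV-C), W-slot EXIT (α), PART 2 of `RelSourceHalf`: **THE (C)^{ε} ⟸ (C) BRIDGE — THE END's
# DISPLAYED ROW `hC` (the `ZfreeSym` antisymmetry of the `ε`-member's relative source `b^{rel,ε}_l`) FOLLOWS FROM ROW (C) OF RECORD IN ITS R-HYB′ FORM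
# (`ZfreeSym` of the FULL member's relative source `b′_l = T♮̃_{l+1} − 𝒜^K_l T♮̃_l`), FOR EVERY `ε`** — MY `RelSourceHalf.relSource_half_eq` ⨾ the OWNER gan24-p1's
# `ZeroModeParity.zsym_halfTable` (INTENT 6, l.50255), with `b′_l`'s `LocStencil₂` class supplied per level (`shape_member`, `Lin4ZeroMode.locStencil₂_lin4`, leaf-06's
# `TableDressingDefect.locStencil₂_diff`)
# (G-an2-4 FORMAL swarm → CRUX TEAM (2), leaf-01 lineage `b2b-balaban-gan24-formalise-leaf-01`, gen 72)

NOT IN PRINT; OUR BOOKKEEPING ([folklore] composition BY NAME; 0 `def`, 0 cited facts, 0 `def … : Prop`, 0 sorry).  HONEST FRAMING (cell contract, verbatim):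
«discharging `BetaPertH` makes Bałaban's UV stability UNCONDITIONAL — a real constructive-QFT result; it is NOT the continuum limit and NOT the Clay problem.»
HONEST DEPENDENCY (verbatim): «continuum YM on T⁴ ⇐ BetaPertH ∧ nine spine estimates (0/9 proved); BetaPertH ⇐ (D1) ∧ (D4) ∧ CAP+tail; G-an2-4 gates asym, D1
and NE2/3/4.»

WHAT (objects as in PART 1 and the (α-END) files; in-block root, `1 ≤ Lc`, border data `hBff hBmm hB`; generic `d`; every `ε l`):
* §1 `locStencil₂_relSource` — the FULL member's relative source `b′_l := T♮̃_{l+1} − 𝒜^K_l T♮̃_l` is `LocStencil₂` at a positive rate (existential constants, per level).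
* §2 **`zsym_relSource_half`** — row (C) of record (`∀ l κ κ′ κ₁ κ₂, zmode Lc (b′_l) κ κ′ (inl κ₁) (inl κ₂) + zmode Lc (b′_l) κ′ κ (inl κ₁) (inl κ₂) = 0`) ⟹ the END's `hC`:
  the same row for `b^{rel,ε}_l := ½ • (b̃_l + ε • P b̃_l) + (𝒜^Ĝ_l y_l − 𝒜^K_l y_l)` (`T2ShapeEvenEndRows.locStencil₂_halfMember_three_of_rows`'s displayed `hC`, every `l`).
Row (C) itself is an2's WANTED row — NOT here.  Asserts NO value of any charge; discharges NOTHING of (C) ∕ `hcell` ∕ «T2Shape» ∕ «T2Drift» ∕ (hW, hWall) ∕ (Q-L); (β) of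
record untouched; NEVER «G-an2-4 closed» as (CONV-C); NOT D1, NOT `BetaPertH`, NOT continuum, NOT Clay.  2026-08-23.
-/

noncomputable section

open Finset
open scoped BigOperators
open Literature.MathematicalPhysics.QuantumFieldTheory
open Literature.MathematicalPhysics.QuantumFieldTheory.Balaban1983to89
open Literature.MathematicalPhysics.QuantumFieldTheory.Balaban1983to89.Beta
open ExpKernelCalculus (MKer Decays)
open OneStepResolventKernel (Fib)
open OneStepKernelFamily (KInvStep decays_KInvStep)
open SecondOrderResponse (W2SymOfK)
open BalabanStepJetsSucc (mmRead)
open BalabanStepW2 (K3OfK M2Of)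
open AffineAveraging (box toSite)
open BalabanCompositeJets (LocStencil₂)
open AveragingMixedJetTables (mixFFAt)
open Summit.QuantumFields.BalabanUV.Beta.TameKernelCalculus (trK)
open Summit.QuantumFields.BalabanUV.Beta.BorderedHessian (sgnK)
open Summit.QuantumFields.BalabanUV.Beta.HessKerDressedUnits (unitK unitS decays_unitK)
open Summit.QuantumFields.BalabanUV.Beta.SecondOrderUnits (unitM unitS₂ unitM₂)
open Summit.QuantumFields.BalabanUV.Beta.AxialDressingRooted (coDressKBmAt one_le_of_neZero)
open Summit.QuantumFields.BalabanUV.Beta.SpineRooted (T2RecAt SpureRecAt M1At)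
open Summit.QuantumFields.BalabanUV.Beta.GAN24.CombesThomas (sfStep smStep)
open Summit.QuantumFields.BalabanUV.Beta.GAN24.T2RecursionAffine (lin4)
open Summit.QuantumFields.BalabanUV.Beta.GAN24.BiStencilZeroMode (Tab zmode)
open Summit.QuantumFields.BalabanUV.Beta.GAN24.T2RecChargeStep (shape_member)
open Summit.QuantumFields.BalabanUV.Beta.GAN24.Lin4ZeroMode (locStencil₂_lin4)
open Summit.QuantumFields.BalabanUV.Beta.GAN24.TableDressingDefect (locStencil₂_diff)
open Summit.QuantumFields.BalabanUV.Beta.GAN24.ZeroModeParity (zsym_halfTable)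
open Summit.QuantumFields.BalabanUV.Beta.GAN24.RelSourceHalf (relSource_half_eq)

namespace Summit.QuantumFields.BalabanUV.Beta.GAN24.RelSourceHalfCharge

variable {d : ℕ} {Lc : ℕ} [NeZero Lc] {r : Fin (d + 1) → ℕ}

/-! ## §1 The full member's relative source is `LocStencil₂` at a positive rate -/

/-- [folklore] **`b′_l := T♮̃_{l+1} − 𝒜^K_l T♮̃_l` IS `LocStencil₂` AT A POSITIVE RATE** (per level; `shape_member (l+1)`, `locStencil₂_lin4` on `shape_member l` through the
decaying undressed unit step, both classes taken to the common rate by `LocStencil₂.mono`, then `locStencil₂_diff`). -/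
theorem locStencil₂_relSource (hLc : 1 ≤ Lc) (hr : r ∈ box (d + 1) Lc) (cE cVH cΛ cE₂ cB : ℝ) (Tc : Fin 4 → Fin 4 → Fin 4 → Fin 4 → ℝ)
    {vh₂S : Tab d} (hB : ∃ C δ : ℝ, 0 < δ ∧ LocStencil₂ vh₂S C δ) (l : ℕ) :
    ∃ C δ : ℝ, 0 < δ ∧ LocStencil₂ (unitS₂ (sfStep Lc (l + 1)) (smStep d Lc (l + 1)) (T2RecAt d Lc (toSite r) cE cVH cΛ cE₂ cB Tc vh₂S (mixFFAt (toSite r) Lc) (l + 1))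
            - lin4 (cE₂ * (Lc : ℝ) ^ (2 * (d + 1))) (unitK (sfStep Lc l) (smStep d Lc l) (KInvStep (d := d) Lc l)) Lc
              (unitS₂ (sfStep Lc l) (smStep d Lc l) (T2RecAt d Lc (toSite r) cE cVH cΛ cE₂ cB Tc vh₂S (mixFFAt (toSite r) Lc) l))) C δ := by
  obtain ⟨C₁, δ₁, hδ₁, h₁⟩ := shape_member hLc hr cE cVH cΛ cE₂ cB Tc hB (l + 1)
  obtain ⟨C₀, δ₀, hδ₀, h₀⟩ := shape_member hLc hr cE cVH cΛ cE₂ cB Tc hB l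
  obtain ⟨δK, CK, hδK, hCK, hK⟩ := decays_KInvStep (d := d) (Lc := Lc) l
  have h₂ := locStencil₂_lin4 (decays_unitK (sf := sfStep Lc l) (sm := smStep d Lc l) hK)
    (mul_nonneg (mul_nonneg ((abs_nonneg _).trans (le_max_left _ _)) hCK) ((abs_nonneg _).trans (le_max_left _ _)))
    hδK hLc (cE₂ * (Lc : ℝ) ^ (2 * (d + 1))) h₀ hδ₀
  exact ⟨_, min δ₁ (min δK δ₀ / 128), lt_min hδ₁ (by positivity),
    locStencil₂_diff (h₁.mono (min_le_left _ _)) (h₂.mono (min_le_right _ _))⟩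

/-! ## §2 The (C)^{ε} ⟸ (C) bridge -/

/-- NOT IN PRINT; OUR BOOKKEEPING.  **ROW (C) OF RECORD ⟹ THE END's `hC`, FOR EVERY `ε`**: if the full member's relative source `b′_l` is `ZfreeSym` (bond-antisymmetric ff
cell charge at period `Lc`) at every level, then so is the `ε`-member's relative source `b^{rel,ε}_l = ½ • (b̃_l + ε • P b̃_l) + (𝒜^Ĝ_l y_l − 𝒜^K_l y_l)` — PART 1's
`relSource_half_eq` rewrites it as `½ • (b′_l + ε • P b′_l)`, the OWNER's `ZeroModeParity.zsym_halfTable` passes the row to the `ε`-half (§1 for the class). -/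
theorem zsym_relSource_half (hLc : 1 ≤ Lc) (hr : r ∈ box (d + 1) Lc) (cE cVH cΛ cE₂ cB : ℝ) (Tc : Fin 4 → Fin 4 → Fin 4 → Fin 4 → ℝ)
    {vh₂S : Tab d} (hBff : ∀ κ u κ' u' x z (α β : Fin (d + 1)), vh₂S κ u κ' u' x z (Sum.inl α) (Sum.inl β) = 0)
    (hBmm : ∀ κ u κ' u' x z (μ ν : Fin (d + 1)), vh₂S κ u κ' u' x z (Sum.inr μ) (Sum.inr ν) = 0)
    (hB : ∃ C δ : ℝ, 0 < δ ∧ LocStencil₂ vh₂S C δ) (ε : ℝ)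
    (hC : ∀ (l : ℕ) (κ κ' κ₁ κ₂ : Fin (d + 1)),
      zmode Lc ((unitS₂ (sfStep Lc (l + 1)) (smStep d Lc (l + 1)) (T2RecAt d Lc (toSite r) cE cVH cΛ cE₂ cB Tc vh₂S (mixFFAt (toSite r) Lc) (l + 1))
            - lin4 (cE₂ * (Lc : ℝ) ^ (2 * (d + 1))) (unitK (sfStep Lc l) (smStep d Lc l) (KInvStep (d := d) Lc l)) Lc
              (unitS₂ (sfStep Lc l) (smStep d Lc l) (T2RecAt d Lc (toSite r) cE cVH cΛ cE₂ cB Tc vh₂S (mixFFAt (toSite r) Lc) l)))) κ κ' (Sum.inl κ₁) (Sum.inl κ₂)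
        + zmode Lc ((unitS₂ (sfStep Lc (l + 1)) (smStep d Lc (l + 1)) (T2RecAt d Lc (toSite r) cE cVH cΛ cE₂ cB Tc vh₂S (mixFFAt (toSite r) Lc) (l + 1))
            - lin4 (cE₂ * (Lc : ℝ) ^ (2 * (d + 1))) (unitK (sfStep Lc l) (smStep d Lc l) (KInvStep (d := d) Lc l)) Lc
              (unitS₂ (sfStep Lc l) (smStep d Lc l) (T2RecAt d Lc (toSite r) cE cVH cΛ cE₂ cB Tc vh₂S (mixFFAt (toSite r) Lc) l)))) κ' κ (Sum.inl κ₁) (Sum.inl κ₂) = 0)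
    (l : ℕ) (κ κ' κ₁ κ₂ : Fin (d + 1)) :
    zmode Lc (((1 / 2 : ℝ) • ((fun κ u κ' u' => (cE₂ * (Lc : ℝ) ^ (2 * (d + 1))) • mmRead Lc (K3OfK
            (unitK (sfStep Lc l) (smStep d Lc l) (coDressKBmAt (toSite r) Lc (KInvStep (d := d) Lc l))) Lc
            (unitS (sfStep Lc l) (smStep d Lc l) (SpureRecAt d Lc (toSite r) cE cVH cΛ l)) (unitM (sfStep Lc l) (smStep d Lc l) (M1At d Lc (toSite r) cΛ l))
            (W2SymOfK (unitK (sfStep Lc l) (smStep d Lc l) (coDressKBmAt (toSite r) Lc (KInvStep (d := d) Lc l))) Lc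
              (unitS (sfStep Lc l) (smStep d Lc l) (SpureRecAt d Lc (toSite r) cE cVH cΛ l)) (unitM (sfStep Lc l) (smStep d Lc l) (M1At d Lc (toSite r) cΛ l)) 0
              (unitM₂ (sfStep Lc l) (smStep d Lc l) (M2Of d Lc (mixFFAt (toSite r) Lc) l))) κ u κ' u') + cB • vh₂S κ u κ' u')
          + ε • fun κ u κ' u' => sgnK (trK ((fun κ u κ' u' => (cE₂ * (Lc : ℝ) ^ (2 * (d + 1))) • mmRead Lc (K3OfK
            (unitK (sfStep Lc l) (smStep d Lc l) (coDressKBmAt (toSite r) Lc (KInvStep (d := d) Lc l))) Lc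
            (unitS (sfStep Lc l) (smStep d Lc l) (SpureRecAt d Lc (toSite r) cE cVH cΛ l)) (unitM (sfStep Lc l) (smStep d Lc l) (M1At d Lc (toSite r) cΛ l))
            (W2SymOfK (unitK (sfStep Lc l) (smStep d Lc l) (coDressKBmAt (toSite r) Lc (KInvStep (d := d) Lc l))) Lc
              (unitS (sfStep Lc l) (smStep d Lc l) (SpureRecAt d Lc (toSite r) cE cVH cΛ l)) (unitM (sfStep Lc l) (smStep d Lc l) (M1At d Lc (toSite r) cΛ l)) 0
              (unitM₂ (sfStep Lc l) (smStep d Lc l) (M2Of d Lc (mixFFAt (toSite r) Lc) l))) κ u κ' u') + cB • vh₂S κ u κ' u') κ u κ' u'))))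
        + (lin4 (cE₂ * (Lc : ℝ) ^ (2 * (d + 1))) (unitK (sfStep Lc l) (smStep d Lc l) (coDressKBmAt (toSite r) Lc (KInvStep (d := d) Lc l))) Lc
              ((1 / 2 : ℝ) • (unitS₂ (sfStep Lc l) (smStep d Lc l) (T2RecAt d Lc (toSite r) cE cVH cΛ cE₂ cB Tc vh₂S (mixFFAt (toSite r) Lc) l)
          + ε • fun κ u κ' u' => sgnK (trK (unitS₂ (sfStep Lc l) (smStep d Lc l) (T2RecAt d Lc (toSite r) cE cVH cΛ cE₂ cB Tc vh₂S (mixFFAt (toSite r) Lc) l) κ u κ' u'))))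
          - lin4 (cE₂ * (Lc : ℝ) ^ (2 * (d + 1))) (unitK (sfStep Lc l) (smStep d Lc l) (KInvStep (d := d) Lc l)) Lc
              ((1 / 2 : ℝ) • (unitS₂ (sfStep Lc l) (smStep d Lc l) (T2RecAt d Lc (toSite r) cE cVH cΛ cE₂ cB Tc vh₂S (mixFFAt (toSite r) Lc) l)
          + ε • fun κ u κ' u' => sgnK (trK (unitS₂ (sfStep Lc l) (smStep d Lc l) (T2RecAt d Lc (toSite r) cE cVH cΛ cE₂ cB Tc vh₂S (mixFFAt (toSite r) Lc) l) κ u κ' u')))))) κ κ' (Sum.inl κ₁) (Sum.inl κ₂)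
      + zmode Lc (((1 / 2 : ℝ) • ((fun κ u κ' u' => (cE₂ * (Lc : ℝ) ^ (2 * (d + 1))) • mmRead Lc (K3OfK
            (unitK (sfStep Lc l) (smStep d Lc l) (coDressKBmAt (toSite r) Lc (KInvStep (d := d) Lc l))) Lc
            (unitS (sfStep Lc l) (smStep d Lc l) (SpureRecAt d Lc (toSite r) cE cVH cΛ l)) (unitM (sfStep Lc l) (smStep d Lc l) (M1At d Lc (toSite r) cΛ l))
            (W2SymOfK (unitK (sfStep Lc l) (smStep d Lc l) (coDressKBmAt (toSite r) Lc (KInvStep (d := d) Lc l))) Lc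
              (unitS (sfStep Lc l) (smStep d Lc l) (SpureRecAt d Lc (toSite r) cE cVH cΛ l)) (unitM (sfStep Lc l) (smStep d Lc l) (M1At d Lc (toSite r) cΛ l)) 0
              (unitM₂ (sfStep Lc l) (smStep d Lc l) (M2Of d Lc (mixFFAt (toSite r) Lc) l))) κ u κ' u') + cB • vh₂S κ u κ' u')
          + ε • fun κ u κ' u' => sgnK (trK ((fun κ u κ' u' => (cE₂ * (Lc : ℝ) ^ (2 * (d + 1))) • mmRead Lc (K3OfK
            (unitK (sfStep Lc l) (smStep d Lc l) (coDressKBmAt (toSite r) Lc (KInvStep (d := d) Lc l))) Lc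
            (unitS (sfStep Lc l) (smStep d Lc l) (SpureRecAt d Lc (toSite r) cE cVH cΛ l)) (unitM (sfStep Lc l) (smStep d Lc l) (M1At d Lc (toSite r) cΛ l))
            (W2SymOfK (unitK (sfStep Lc l) (smStep d Lc l) (coDressKBmAt (toSite r) Lc (KInvStep (d := d) Lc l))) Lc
              (unitS (sfStep Lc l) (smStep d Lc l) (SpureRecAt d Lc (toSite r) cE cVH cΛ l)) (unitM (sfStep Lc l) (smStep d Lc l) (M1At d Lc (toSite r) cΛ l)) 0
              (unitM₂ (sfStep Lc l) (smStep d Lc l) (M2Of d Lc (mixFFAt (toSite r) Lc) l))) κ u κ' u') + cB • vh₂S κ u κ' u') κ u κ' u'))))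
        + (lin4 (cE₂ * (Lc : ℝ) ^ (2 * (d + 1))) (unitK (sfStep Lc l) (smStep d Lc l) (coDressKBmAt (toSite r) Lc (KInvStep (d := d) Lc l))) Lc
              ((1 / 2 : ℝ) • (unitS₂ (sfStep Lc l) (smStep d Lc l) (T2RecAt d Lc (toSite r) cE cVH cΛ cE₂ cB Tc vh₂S (mixFFAt (toSite r) Lc) l)
          + ε • fun κ u κ' u' => sgnK (trK (unitS₂ (sfStep Lc l) (smStep d Lc l) (T2RecAt d Lc (toSite r) cE cVH cΛ cE₂ cB Tc vh₂S (mixFFAt (toSite r) Lc) l) κ u κ' u'))))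
          - lin4 (cE₂ * (Lc : ℝ) ^ (2 * (d + 1))) (unitK (sfStep Lc l) (smStep d Lc l) (KInvStep (d := d) Lc l)) Lc
              ((1 / 2 : ℝ) • (unitS₂ (sfStep Lc l) (smStep d Lc l) (T2RecAt d Lc (toSite r) cE cVH cΛ cE₂ cB Tc vh₂S (mixFFAt (toSite r) Lc) l)
          + ε • fun κ u κ' u' => sgnK (trK (unitS₂ (sfStep Lc l) (smStep d Lc l) (T2RecAt d Lc (toSite r) cE cVH cΛ cE₂ cB Tc vh₂S (mixFFAt (toSite r) Lc) l) κ u κ' u')))))) κ' κ (Sum.inl κ₁) (Sum.inl κ₂) = 0 := by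
  obtain ⟨C, δ, hδ, hrel⟩ := locStencil₂_relSource hLc hr cE cVH cΛ cE₂ cB Tc hB l
  rw [relSource_half_eq hLc hr cE cVH cΛ cE₂ cB Tc hBff hBmm hB ε l]
  exact zsym_halfTable hrel hδ (hC l) (1 / 2 : ℝ) ε κ κ' κ₁ κ₂

end Summit.QuantumFields.BalabanUV.Beta.GAN24.RelSourceHalfCharge

end
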